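import Summits.QuantumFields.BalabanUV.T4Continuum.Support.B13StepOfRecordSecantTermwise
import Summits.QuantumFields.BalabanUV.T4Continuum.Support.OutputRateActOpFibre
import Summits.QuantumFields.BalabanUV.T4Continuum.Support.OutputRateInsertionStructural

/-!
# NE5 ∕ U3 — the SECANT END ON BAŁABAN's CARRIERS OF RECORD WITH **BOTH HALVES OF W2 IN THE ROW OWNER's STRUCTURAL CURRENCIES**:
# the operator-species modulus `OpLipschitz` PRODUCED from the activity-level FIBRE shape `ActOpFibre` (owner's `OutputRateActOpFibre`,
# p213673 — universal relative modulus `1∕(1 − ρ₀)`), one level down from `ActOpIntegral`; the insertion species' one-run envelope ∕ bound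
# PRODUCED from the COMPOSITION shape `InsOpComposition` (owner's `OutputRateInsertionStructural`, p213777)

Cell `pub-balaban`, unit `b2b-balaban-t4-ne5-formalise-leaf-01` (NE5 formalisation swarm, LEAF PROVER 01, gen 5; journal INTENT
`B13StepOfRecordSecantStructural` l.10104; a FOLLOWER of this lineage's `B13StepOfRecordSecantTermwise` p213235 (E8[rec] termwise),
consuming the row owner's `OutputRateActOpFibre` ∕ `OutputRateInsertionStructural` BY NAME — applications in a new module, no owner ∕ P2
file edited).  Summits-side NEW WORK under the LEAN PLACEMENT RULE (cell bookkeeping; NOT a Literature module).  HONEST FRAMING: rung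
(B)+1 of the FINITE-VOLUME T⁴ continuum programme — NOT infinite volume, NOT a mass gap, NOT the Clay problem, and **NOT A PROOF OF NE5,
NOR OF W2-op, NOR OF W2-ins**: both walls are RELOCATED TO STRUCTURE exactly as the owner's modules say (operator half: the (H-rep)
dictionary «each (2.14) factor is a dominated holomorphic parametric integral of the operator datum» + the MARGIN on the complex operator
ball — [Balaban1988RG2Cluster] (2.15)–(2.17) pp. 15–16 re-read at complex operator data, NOT PRINTED; insertion half: table functional
analytic + bounded on a configuration domain ∘ configuration map holomorphic in the insertion-operator datum — KIND [Balaban1987RG1]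
(1.9)∕(1.18) pp. 261∕263, [Balaban1988RG2Cluster] Lemma 1 (1.34)∕(1.36) p. 9, locators only), not discharged; every other analytic input
(W3 slice budgets; L05∕L06 quoted from [Balaban1987RG1] (1.18) p. 263; W1 in row NE2's currency; the insertion NE2-TYPE rate + reach;
the per-activity structure ∕ exponent bounds ∕ majorants with decay split; the (2.38) SHAPES — Lemma 3 (2.38) p. 20, locator only;
radii; numerics) is a DISPLAYED HYPOTHESIS.  HONEST DEPENDENCY (cell line, verbatim): continuum YM on T⁴ ⇐ BetaPertH ∧ nine spine
estimates (0/9 proved); BetaPertH ⇐ (D1) ∧ (D4) ∧ CAP+tail; G-an2-4 gates asym, D1 and NE2/3/4.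

WHAT THIS FILE DOES.
* §1 **`opLipschitz_socket_of_actOpFibre`** (generic socket `labelsIndexing G D` ∕ `touchInc G`, any step model with `M.Out = out …`)
  and **`opLipschitz_record_of_actOpFibre`** (the MODEL OF RECORD `B13StepOfRecord.step S E₀ cB`): `B13StepOfRecordSecantTermwise`'s
  `opLipschitz_socket_of_actNormDecay` ∕ `opLipschitz_record_of_actOpShapes` with P2's termwise `ActOpBound … ρ₀ A` ∕ `ActOpLip … ρ₀ N A`
  PRODUCED by the owner's `actOpBound_of_fibre` ∕ `actOpLip_of_fibre` from ONE shape `ActOpFibre 𝒯 act M W A` and `0 ≤ ρ₀ < 1` — the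
  relative modulus is the universal constant `N ≡ N̄ := 1∕(1 − ρ₀)`; so `OpLipschitz M W κ ((1∕(1−ρ₀))·Φ′∕(1−4νΦ′)²) ρ₀` on the socket
  and `OpLipschitz (step S E₀ cB) W κ ((1∕(1−ρ₀))·Φ₀∕(1−36Φ₀)²) ρ₀` on the record (`Φ₀ = ε·e^{64}·K₀(64,8)` from the (2.38) shape).
* §2 **`ne5_of_record_secant_structural`** — E8[rec] = `ne5_of_record_secant_termwise` with (i) its FIVE operator binders
  `hopB hopL hNop0 hNople hNopbar` replaced by `hfib : ActOpFibre …` (+ `ρ₀ < 1`), and (ii) its two insertion-species binders `hienv` ∕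
  `hibdA` (`InsOpEnvelope` ∕ `InsBoundA`, W2-ins KIND) replaced by ONE `hcomp : InsOpComposition (S.D.toInsOpModel (step S E₀ cB) rI hrI) W κ
  E₀ Gi cfg Φ 𝒪 Dc` + the membership `hIA` of run A's insertion-operator datum in the operator domain (owner's
  `insOpEnvelope_of_composition` ∕ `insBoundA_of_composition`).  Conclusion LITERALLY `NE5 (outA S E₀ cB) (outB S E₀ cB) W κ θ′ C₅` with
  `C₅` = the termwise END's constant at `N̄op := 1∕(1 − ρ₀)`.
* §3 **`exists_ne5_of_record_secant_structural_readAt`** — §2 at leaf-03's read-at slot packages `readAtSlots S ι` (reading BY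
  CONSTRUCTION) with leaf L10's letters `k₀`, `B` eliminated (`0 < θ < 1`, `0 < ρ₀ < 1`): `∃ C₅, NE5 (outA (readAtSlots S ι) E₀ cB) …`.
* §4 **`ne5_of_record_secant_integral`** — §2 one level down on the operator side: `hint : ActOpIntegral 𝒯 S.act (step S E₀ cB) W Aop μ f
  𝒪op` (each (2.14) factor IS a dominated holomorphic parametric integral of the operator datum on a domain containing the closed operator
  ball, ONE majorant of mass `≤ Aop`) via the owner's `actOpFibre_of_integral`.
CENSUS DELTA against this lineage's `g4/CENSUS-secant-record-v2.md`: operator side 5 displayed binders → 1 structural shape (+ `ρ₀ < 1`);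
insertion side 2 displayed binders → 1 structural shape (+ 1 membership).  Nothing is asserted about [II]'s kernels ∕ potentials ∕ terms
(the `Slots`, the structural shapes and the configuration data `cfg ∕ Φ ∕ 𝒪 ∕ Dc` stay PARAMETERS ∕ HYPOTHESES); nothing of print is
discharged; 0 sorry; axioms ⊆ {propext, Classical.choice, Quot.sound}.
-/

noncomputable section

open scoped BigOperators
open Metric Set MeasureTheory

namespace Summit.QuantumFields.BalabanUV.T4Continuum.B13StepOfRecordSecantStructural

open Literature.MathematicalPhysics.QuantumFieldTheory.Balaban1983to89
open Literature.MathematicalPhysics.QuantumFieldTheory.Balaban1983to89.T4OutputRate (Carriers DecayBound NE5)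
open Literature.MathematicalPhysics.QuantumFieldTheory.Balaban1983to89.T4InputCauchyRateData (StepModel)
open Literature.MathematicalPhysics.QuantumFieldTheory.Balaban1983to89.T4InputCauchyRateSpecies (ballClass OpLipschitz)
open Literature.MathematicalPhysics.QuantumFieldTheory.Balaban1983to89.B13FamilySum (Ineq227)
open Summit.QuantumFields.BalabanUV.T4Continuum.ClusterRepOfDomains (DomainGeometry)
open Summit.QuantumFields.BalabanUV.T4Continuum.B13Carriers (TwoRuns)
open Summit.QuantumFields.BalabanUV.T4Continuum.B13OpDatum (OpDatum)
open Summit.QuantumFields.BalabanUV.T4Continuum.B13OpDatumJunctions (RawBounded WeightedEntrywiseRate)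
open Summit.QuantumFields.BalabanUV.T4Continuum.B13StepTermLabels (InnerLabel InnerData)
open Summit.QuantumFields.BalabanUV.T4Continuum.B13StepTermFamily (ActData ActExpLinearOn out)
open Summit.QuantumFields.BalabanUV.T4Continuum.B13StepTermSocket (labelsIndexing touchInc)
open Summit.QuantumFields.BalabanUV.T4Continuum.B13InnerData (Bnd b13InnerData)
open Summit.QuantumFields.BalabanUV.T4Continuum.B13Base (selfCtr)
open Summit.QuantumFields.BalabanUV.T4Continuum.B13Represents (Assembly)
open Summit.QuantumFields.BalabanUV.T4Continuum.UrsellTreeSum (ind)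
open Summit.QuantumFields.BalabanUV.T4Continuum.UrsellTermBudget (actSum)
open Summit.QuantumFields.BalabanUV.T4Continuum.B13ActMajorantLevels (polyWeight)
open Summit.QuantumFields.BalabanUV.T4Continuum.B13TermHistSecant (ActExpNormBound ActAbsBound)
open Summit.QuantumFields.BalabanUV.T4Continuum.B13DomainGeometryTR (domainGeometry)
open Summit.QuantumFields.BalabanUV.T4Continuum.B13StepOfRecord (Slots assembly step outA outB)
open Summit.QuantumFields.BalabanUV.T4Continuum.UrsellOfRecordFaces (phi_nonneg)
open Summit.QuantumFields.BalabanUV.T4Continuum.B13StepOfRecordReadAt (readAtSlots transportReads_record_readAt)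
open Summit.QuantumFields.BalabanUV.T4Continuum.B13StepOfRecordSecantTermwise (opLipschitz_socket_of_actNormDecay
  opLipschitz_record_of_actOpShapes ne5_of_record_secant_termwise)
open Summit.QuantumFields.BalabanUV.T4Continuum.OutputRateActOpFibre (ActOpFibre ActOpIntegral actOpBound_of_fibre actOpLip_of_fibre
  actOpFibre_of_integral)
open Summit.QuantumFields.BalabanUV.T4Continuum.OutputRateInsertionStructural (InsOpComposition insOpEnvelope_of_composition
  insBoundA_of_composition)

/-! ## §1 `OpLipschitz` from the FIBRE shape: on the socket and on the model of record -/

section Socket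

variable {C : Carriers} [DecidableEq C.Dom] {Cube : Type*} [DecidableEq Cube] {Bnd : Type*} [DecidableEq Bnd]
  (G : DomainGeometry C Cube) (D : InnerData C Bnd) {Op Hist : Type*} [NormedAddCommGroup Op] [NormedSpace ℂ Op]
  [NormedAddCommGroup Hist] [NormedSpace ℂ Hist] (act : C.Dom → InnerLabel C.Dom Bnd → Op → Hist → ℂ)

/-- The universal relative modulus `1∕(1 − ρ₀)` of the fibre route is nonnegative for `ρ₀ ≤ 1`. [folklore] -/
theorem modulus_nonneg {ρ₀ : ℝ} (hρ₀1 : ρ₀ ≤ 1) : 0 ≤ 1 / (1 - ρ₀) :=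
  div_nonneg zero_le_one (sub_nonneg.2 hρ₀1)

/-- [folklore] **`OpLipschitz` ON THE SOCKET FROM THE FIBRE SHAPE AND THE ANCHORED NORM ALONE.**  For a step model with
`M.Out = out (labelsIndexing G D) (touchInc G) act`: the owner's activity-level FIBRE shape `ActOpFibre … A` (each (2.14) factor complex
differentiable and bounded by `A` along every complex operator line within the operator margin; NOT PRINTED — KIND
[Balaban1988RG2Cluster] (2.15)–(2.17) pp. 15–16 at complex operator data), `0 ≤ ρ₀ < 1`, a decay split `A ≤ A′·e^{−κ(d(Z)+c)}`, the
(2.27) shape at every domain, footprint locality ∕ reach (`ν`) and the anchored exponential norm `Φ′` of `A′` with `4νΦ′ < 1` ⟹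
`OpLipschitz M W κ ((1∕(1−ρ₀))·Φ′∕(1−4νΦ′)²) ρ₀` — `opLipschitz_socket_of_actNormDecay` with `hopB := actOpBound_of_fibre`,
`hopL := actOpLip_of_fibre` (relative modulus `N ≡ N̄ := 1∕(1 − ρ₀)`). -/
theorem opLipschitz_socket_of_actOpFibre {M : StepModel C Op Hist}
    (hM : ∀ k o h X, M.Out k o h X = out (labelsIndexing G D) (touchInc G) act k o h X) {W : Set (ℕ → ℝ)}
    {A A' : ℕ → (ℕ → ℝ) → C.BgB → C.Dom → InnerLabel C.Dom Bnd → ℝ} {ρ₀ κ c ν Φ' : ℝ} (hρ₀ : 0 ≤ ρ₀) (hρ₀1 : ρ₀ < 1) (hκ : 0 ≤ κ)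
    (hc : 0 ≤ c) (hfib : ActOpFibre (labelsIndexing G D) act M W A)
    (hA0 : ∀ k g U Z ℓ, 0 ≤ A k g U Z ℓ) (hA0' : ∀ k g U Z ℓ, 0 ≤ A' k g U Z ℓ)
    (hdec : ∀ k g U Z ℓ, A k g U Z ℓ ≤ A' k g U Z ℓ * Real.exp (-(κ * (C.d Z + c))))
    (h227 : ∀ X : C.Dom, Ineq227 (G.level (C.scale X)) G.cubes C.d (G.cubes X) (C.d X) c)
    (reach : C.Dom → Finset Cube) (hloc : ∀ Z Z', touchInc G Z' Z → ∃ q ∈ reach Z, q ∈ G.cubes Z') (hν : 0 ≤ ν)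
    (hreach : ∀ Z, ((reach Z).card : ℝ) ≤ ν * (G.cubes Z).card) (hΦ0 : 0 ≤ Φ') (hsmall : 4 * ν * Φ' < 1)
    (hΦ : ∀ k, ∀ g ∈ W, ∀ (U : C.BgB) (q : Cube),
      ∑ Z ∈ G.level k, ind (q ∈ G.cubes Z) * polyWeight D (A' k g U) k Z * Real.exp ((G.cubes Z).card) ≤ Φ') :
    OpLipschitz M W κ (1 / (1 - ρ₀) * (Φ' / (1 - 4 * ν * Φ') ^ 2)) ρ₀ :=
  opLipschitz_socket_of_actNormDecay G D act hM (N := fun _ _ _ _ _ => 1 / (1 - ρ₀)) hρ₀ hκ hc (actOpBound_of_fibre hfib hρ₀1.le)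
    (actOpLip_of_fibre hfib hρ₀1) (fun _ _ _ _ _ => modulus_nonneg hρ₀1.le) (fun _ _ _ _ _ => le_rfl) (modulus_nonneg hρ₀1.le)
    hA0 hA0' hdec h227 reach hloc hν hreach hΦ0 hsmall hΦ

end Socket

section OfRecord

variable {𝔾 : Type} [GaugeGroup 𝔾] {R : TwoRuns 𝔾} {E IOp Hist Ω : Type*} [NormedAddCommGroup Hist] [NormedSpace ℂ Hist]
  [CompleteSpace Hist] [NormedAddCommGroup IOp] [NormedSpace ℂ IOp] [MeasurableSpace Ω] (S : Slots R E IOp Hist) (E₀ cB : ℝ)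

omit [CompleteSpace Hist] [NormedAddCommGroup IOp] [NormedSpace ℂ IOp] in
/-- [folklore] **`OpLipschitz` ON THE MODEL OF RECORD FROM THE FIBRE SHAPE AND THE (2.38) SHAPE ALONE.**
`opLipschitz_record_of_actOpShapes` (geometry by the TR theorems: (2.27) with c = 5, footprint locality, reach ν = 9; anchored norm
`Φ₀ = ε·e^{64}·K₀(64,8)` from the (2.38)-shaped polymer sums of the stripped majorant + rate room `64·log 162 + 64 ≤ Rt`) with its
termwise operator data PRODUCED from `hfib : ActOpFibre (labelsIndexing (domainGeometry R) (b13InnerData R)) S.act (step S E₀ cB) W A`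
and `0 ≤ ρ₀ < 1`: `OpLipschitz (step S E₀ cB) W κ ((1∕(1−ρ₀))·Φ₀∕(1−36Φ₀)²) ρ₀`.  The `hopL` binder of E8[rec] RELOCATED to the owner's
structural fibre shape (wall G-ne5p1-1′ relocated to (H-rep) + margin, NOT discharged). -/
theorem opLipschitz_record_of_actOpFibre {W : Set (ℕ → ℝ)}
    {A A' : ℕ → (ℕ → ℝ) → R.carriers.BgB → R.carriers.Dom → InnerLabel R.carriers.Dom (Bnd R) → ℝ} {ρ₀ κ ε Rt : ℝ}
    (hρ₀ : 0 ≤ ρ₀) (hρ₀1 : ρ₀ < 1) (hκ : 0 ≤ κ)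
    (hfib : ActOpFibre (labelsIndexing (domainGeometry R) (b13InnerData R)) S.act (step S E₀ cB) W A)
    (hA0 : ∀ k g U Z ℓ, 0 ≤ A k g U Z ℓ) (hA0' : ∀ k g U Z ℓ, 0 ≤ A' k g U Z ℓ)
    (hdec : ∀ k g U Z ℓ, A k g U Z ℓ ≤ A' k g U Z ℓ * Real.exp (-(κ * (R.carriers.d Z + 5)))) (hε : 0 ≤ ε)
    (h238 : ∀ k, ∀ g ∈ W, ∀ (U : R.carriers.BgB), ∀ Z ∈ R.domAt k,
      actSum (b13InnerData R) (A' k g U) k Z ≤ ε * Real.exp (-(Rt * R.carriers.d Z)))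
    (hRt : 64 * Real.log 162 + 64 ≤ Rt) (hΦsmall : 36 * (ε * Real.exp 64 * B12TreeDecay.K₀ (4 * 2 ^ 4) (2 * 4)) < 1) :
    OpLipschitz (step S E₀ cB) W κ (1 / (1 - ρ₀) * ((ε * Real.exp 64 * B12TreeDecay.K₀ (4 * 2 ^ 4) (2 * 4)) /
          (1 - 36 * (ε * Real.exp 64 * B12TreeDecay.K₀ (4 * 2 ^ 4) (2 * 4))) ^ 2)) ρ₀ :=
  opLipschitz_record_of_actOpShapes S E₀ cB (N := fun _ _ _ _ _ => 1 / (1 - ρ₀)) hρ₀ hκ (actOpBound_of_fibre hfib hρ₀1.le)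
    (actOpLip_of_fibre hfib hρ₀1) (fun _ _ _ _ _ => modulus_nonneg hρ₀1.le) (fun _ _ _ _ _ => le_rfl) (modulus_nonneg hρ₀1.le)
    hA0 hA0' hdec hε h238 hRt hΦsmall

/-! ## §2 The secant END of record with BOTH halves of W2 in structural currencies -/

/-- [folklore] **E8[rec] WITH NO PER-ACTIVITY OPERATOR-MODULUS BINDER AND NO INSERTION-ENVELOPE BINDER LEFT.**
`B13StepOfRecordSecantTermwise.ne5_of_record_secant_termwise` with (i) `hopB hopL hNop0 hNople hNopbar` := the owner's
`actOpBound_of_fibre` ∕ `actOpLip_of_fibre` at ONE displayed structural shape `hfib : ActOpFibre … S.act (step S E₀ cB) W Aop` and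
`0 ≤ ρ₀ < 1` (`N̄op := 1∕(1 − ρ₀)`), and (ii) `hienv hibdA` := the owner's `insOpEnvelope_of_composition` ∕ `insBoundA_of_composition` at
ONE displayed structural shape `hcomp : InsOpComposition (S.D.toInsOpModel (step S E₀ cB) rI hrI) W κ E₀ Gi cfg Φ 𝒪 Dc` (configuration map
`cfg` holomorphic on `𝒪 ⊇` the closed insertion-operator ball and mapping into `Dc`, table functional `Φ` holomorphic on `Dc` and bounded
by `Gi·rHist`; insertion = `Φ ∘ cfg` on `𝒪`) + `hIA` (run A's insertion-operator datum lies in `𝒪`).  DISPLAYED afterwards, binder for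
binder: the transport READING `hT` (gone on read-at packages, §3); W3 slice budgets ×2 (wall O3); L05∕L06 (quoted); W1 entry data (row NE2);
insertion NE2-TYPE rate + reach; the per-activity STRUCTURE `ActExpLinearOn`; history-side `0 ≤ N ≤ N̄`, `A ≤ A′e^{−κ(d+5)}`, (2.38) shape
of `A′`; operator-side `ActOpFibre`, `Aop ≤ Aop′e^{−κ(d+5)}`, (2.38) shape of `Aop′`; radii; signs; numerics.  Conclusion LITERALLY
`NE5 (outA S E₀ cB) (outB S E₀ cB) W κ θ′ C₅`.  NOT a proof of NE5. -/
theorem ne5_of_record_secant_structural {W : Set (ℕ → ℝ)} {ROp RHist : ℕ → ℝ}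
    {N A A' Aop Aop' : ℕ → (ℕ → ℝ) → R.carriers.BgB → R.carriers.Dom → InnerLabel R.carriers.Dom (Bnd R) → ℝ}
    {Dt : ActData R.carriers.Dom (InnerLabel R.carriers.Dom (Bnd R)) (OpDatum E) Hist Ω}
    {κ Nbar ε εop Rt EA₀ E₁ cA c₁ r₀ Gi δI ρ₁ θ θ' ρ₀ B : ℝ} {k₀ k₁ : ℕ} (rI : ℕ → ℝ) (hrI : ∀ k, 0 < rI k)
    {Cfg : ℕ → Type*} [∀ k, NormedAddCommGroup (Cfg k)] [∀ k, NormedSpace ℂ (Cfg k)] {cfg : ∀ k, IOp → Cfg k}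
    {Φ : ∀ k, (R.carriers.Dom → ℝ) → Cfg k → Hist} {𝒪 : ℕ → (ℕ → ℝ) → R.carriers.BgB → Set IOp}
    {Dc : ∀ k, (ℕ → ℝ) → R.carriers.BgB → Set (Cfg k)}
    (hT : (assembly S).TransportReads W)
    (hbB : (assembly S).SliceBudgetB W κ cB) (hbA : S.D.SliceBudget (step S E₀ cB) W κ cA)
    (hdA : DecayBound (outA S E₀ cB) W EA₀ κ) (hdB : DecayBound (outB S E₀ cB) W E₀ κ)
    (hRA : RawBounded S.F (assembly S).rawAt W) (hRB : RawBounded S.F S.rawB W)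
    (hwer : WeightedEntrywiseRate S.F (assembly S).rawAt S.rawB W c₁ fun k => θ ^ k) (hfl : ∀ k, r₀ ≤ S.rOp k)
    (hcomp : InsOpComposition (S.D.toInsOpModel (step S E₀ cB) rI hrI) W κ E₀ Gi cfg Φ 𝒪 Dc)
    (hIA : ∀ k, ∀ g ∈ W, ∀ (U : R.carriers.BgB), (S.D.toInsOpModel (step S E₀ cB) rI hrI).opIA g U k ∈ 𝒪 k g U)
    (hirate : (S.D.toInsOpModel (step S E₀ cB) rI hrI).InsOpRate W δI θ) (hδI : 0 ≤ δI) (hGi : 0 ≤ Gi) (hρ₁ : ρ₁ < 1)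
    (hreachI : δI * θ ^ k₁ ≤ ρ₁)
    (hfib : ActOpFibre (labelsIndexing (domainGeometry R) (b13InnerData R)) S.act (step S E₀ cB) W Aop)
    (hAop0 : ∀ k g U Z ℓ, 0 ≤ Aop k g U Z ℓ) (hAop0' : ∀ k g U Z ℓ, 0 ≤ Aop' k g U Z ℓ)
    (hdecop : ∀ k g U Z ℓ, Aop k g U Z ℓ ≤ Aop' k g U Z ℓ * Real.exp (-(κ * (R.carriers.d Z + 5)))) (hεop : 0 ≤ εop)
    (h238op : ∀ k, ∀ g ∈ W, ∀ (U : R.carriers.BgB), ∀ Z ∈ R.domAt k,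
      actSum (b13InnerData R) (Aop' k g U) k Z ≤ εop * Real.exp (-(Rt * R.carriers.d Z)))
    (hΦopsmall : 36 * (εop * Real.exp 64 * B12TreeDecay.K₀ (4 * 2 ^ 4) (2 * 4)) < 1)
    (hexp : ActExpLinearOn (labelsIndexing (domainGeometry R) (b13InnerData R)) S.act Dt
      (ballClass (selfCtr (assembly S).raw (assembly S).histRef) ROp RHist) W)
    (hN : ActExpNormBound (labelsIndexing (domainGeometry R) (b13InnerData R)) Dt
      (ballClass (selfCtr (assembly S).raw (assembly S).histRef) ROp RHist) W S.rHist N)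
    (hN0 : ∀ k g U Z ℓ, 0 ≤ N k g U Z ℓ) (hNle : ∀ k g U Z ℓ, N k g U Z ℓ ≤ Nbar) (hNbar : 0 ≤ Nbar)
    (habs : ActAbsBound (labelsIndexing (domainGeometry R) (b13InnerData R)) Dt
      (ballClass (selfCtr (assembly S).raw (assembly S).histRef) ROp RHist) W A)
    (hA0 : ∀ k g U Z ℓ, 0 ≤ A k g U Z ℓ) (hA0' : ∀ k g U Z ℓ, 0 ≤ A' k g U Z ℓ) (hκ : 0 ≤ κ)
    (hdec : ∀ k g U Z ℓ, A k g U Z ℓ ≤ A' k g U Z ℓ * Real.exp (-(κ * (R.carriers.d Z + 5))))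
    (hε : 0 ≤ ε)
    (h238 : ∀ k, ∀ g ∈ W, ∀ (U : R.carriers.BgB), ∀ Z ∈ R.domAt k,
      actSum (b13InnerData R) (A' k g U) k Z ≤ ε * Real.exp (-(Rt * R.carriers.d Z)))
    (hRt : 64 * Real.log 162 + 64 ≤ Rt) (hΦsmall : 36 * (ε * Real.exp 64 * B12TreeDecay.K₀ (4 * 2 ^ 4) (2 * 4)) < 1)
    (hOp : ∀ k, c₁ / r₀ * S.rOp k ≤ ROp k) (hHist : ∀ k, (assembly S).bHist E₀ cB k ≤ RHist k)
    (hHistA : ∀ k, (Gi * δI / (1 - ρ₁) + 2 * Gi / θ ^ k₁) * S.rHist k + EA₀ * (S.rHist k * (cA / (1 - S.D.ω))) ≤ RHist k)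
    (hEA₀ : 0 ≤ EA₀) (hE₀ : 0 ≤ E₀) (hE₁ : 0 < E₁) (hcA : 0 ≤ cA) (hcB : 0 ≤ cB)
    (hc₁ : 0 ≤ c₁) (hr₀ : 0 < r₀) (hθ0 : 0 < θ) (hθθ' : θ ≤ θ') (hθ'1 : θ' ≤ 1) (hω : 0 < S.D.ω)
    (hω1 : S.D.ω < 1) (hρ₀ : 0 ≤ ρ₀) (hρ₀1 : ρ₀ < 1) (hreach : c₁ / r₀ * θ ^ k₀ ≤ ρ₀) (hB : 0 ≤ B) (hfirst : ∀ k < k₀, EA₀ + E₀ ≤ B * θ ^ k)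
    (hsmall : S.D.ω + 2 * (Nbar * ((ε * Real.exp 64 * B12TreeDecay.K₀ (4 * 2 ^ 4) (2 * 4)) /
          (1 - 36 * (ε * Real.exp 64 * B12TreeDecay.K₀ (4 * 2 ^ 4) (2 * 4))) ^ 2)) * cA < θ') :
    NE5 (outA S E₀ cB) (outB S E₀ cB) W κ θ'
      (((1 / (1 - ρ₀) * ((εop * Real.exp 64 * B12TreeDecay.K₀ (4 * 2 ^ 4) (2 * 4)) /
          (1 - 36 * (εop * Real.exp 64 * B12TreeDecay.K₀ (4 * 2 ^ 4) (2 * 4))) ^ 2)) * (c₁ / r₀) + 2 * (Nbar * ((ε * Real.exp 64 * B12TreeDecay.K₀ (4 * 2 ^ 4) (2 * 4)) /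
          (1 - 36 * (ε * Real.exp 64 * B12TreeDecay.K₀ (4 * 2 ^ 4) (2 * 4))) ^ 2)) *
          (Gi * δI / (1 - ρ₁) + 2 * Gi / θ ^ k₁) + B) * (θ' - S.D.ω) /
        (θ' - (S.D.ω + 2 * (Nbar * ((ε * Real.exp 64 * B12TreeDecay.K₀ (4 * 2 ^ 4) (2 * 4)) /
          (1 - 36 * (ε * Real.exp 64 * B12TreeDecay.K₀ (4 * 2 ^ 4) (2 * 4))) ^ 2)) * cA))) :=
  ne5_of_record_secant_termwise S E₀ cB rI hrI hT hbB hbA hdA hdB hRA hRB hwer hfl (insOpEnvelope_of_composition hcomp)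
    (insBoundA_of_composition hcomp hIA) hirate hδI hGi hρ₁ hreachI (actOpBound_of_fibre hfib hρ₀1.le) (actOpLip_of_fibre hfib hρ₀1)
    (fun _ _ _ _ _ => modulus_nonneg hρ₀1.le) (fun _ _ _ _ _ => le_rfl) (modulus_nonneg hρ₀1.le) hAop0 hAop0' hdecop hεop h238op
    hΦopsmall hexp hN hN0 hNle hNbar habs hA0 hA0' hκ hdec hε h238 hRt hΦsmall hOp hHist hHistA hEA₀ hE₀ hE₁ hcA hcB hc₁ hr₀ hθ0
    hθθ' hθ'1 hω hω1 hρ₀ hreach hB hfirst hsmall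

/-! ## §3 The most reduced structural face: read-at slot packages, leaf L10's letters eliminated -/

/-- [folklore] **THE MOST REDUCED SECANT FACE OF RECORD IN STRUCTURAL CURRENCIES**: §2 for the slot package READ AT THE TRANSPORTED
BACKGROUND `readAtSlots S ι` (leaf-03's p212254 — the reading by construction, `transportReads_record_readAt`) with leaf L10's letters
`k₀`, `B` ELIMINATED (`0 < θ < 1`, `0 < ρ₀ < 1`; leaf-10's `reach_scale_exists` ∕ `first_scales_const`, `E₁ := 1`):
`∃ C₅, NE5 (outA (readAtSlots S ι) E₀ cB) (outB (readAtSlots S ι) E₀ cB) W κ θ′ C₅` from displayed binders NONE of which is a class-level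
or per-activity W2 modulus statement, an insertion envelope, or a reading. -/
theorem exists_ne5_of_record_secant_structural_readAt (ι : (ℕ → ℝ) → R.carriers.BgA → ℕ → IOp) {W : Set (ℕ → ℝ)}
    {ROp RHist : ℕ → ℝ} {N A A' Aop Aop' : ℕ → (ℕ → ℝ) → R.carriers.BgB → R.carriers.Dom → InnerLabel R.carriers.Dom (Bnd R) → ℝ}
    {Dt : ActData R.carriers.Dom (InnerLabel R.carriers.Dom (Bnd R)) (OpDatum E) Hist Ω}
    {κ Nbar ε εop Rt EA₀ cA c₁ r₀ Gi δI ρ₁ θ θ' ρ₀ : ℝ} {k₁ : ℕ} (rI : ℕ → ℝ) (hrI : ∀ k, 0 < rI k)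
    {Cfg : ℕ → Type*} [∀ k, NormedAddCommGroup (Cfg k)] [∀ k, NormedSpace ℂ (Cfg k)] {cfg : ∀ k, IOp → Cfg k}
    {Φ : ∀ k, (R.carriers.Dom → ℝ) → Cfg k → Hist} {𝒪 : ℕ → (ℕ → ℝ) → R.carriers.BgB → Set IOp}
    {Dc : ∀ k, (ℕ → ℝ) → R.carriers.BgB → Set (Cfg k)}
    (hbB : (assembly (readAtSlots S ι)).SliceBudgetB W κ cB)
    (hbA : (readAtSlots S ι).D.SliceBudget (step (readAtSlots S ι) E₀ cB) W κ cA)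
    (hdA : DecayBound (outA (readAtSlots S ι) E₀ cB) W EA₀ κ) (hdB : DecayBound (outB (readAtSlots S ι) E₀ cB) W E₀ κ)
    (hRA : RawBounded S.F (assembly (readAtSlots S ι)).rawAt W) (hRB : RawBounded S.F S.rawB W)
    (hwer : WeightedEntrywiseRate S.F (assembly (readAtSlots S ι)).rawAt S.rawB W c₁ fun k => θ ^ k) (hfl : ∀ k, r₀ ≤ S.rOp k)
    (hcomp : InsOpComposition ((readAtSlots S ι).D.toInsOpModel (step (readAtSlots S ι) E₀ cB) rI hrI) W κ E₀ Gi cfg Φ 𝒪 Dc)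
    (hIA : ∀ k, ∀ g ∈ W, ∀ (U : R.carriers.BgB), ((readAtSlots S ι).D.toInsOpModel (step (readAtSlots S ι) E₀ cB) rI hrI).opIA g U k ∈ 𝒪 k g U)
    (hirate : ((readAtSlots S ι).D.toInsOpModel (step (readAtSlots S ι) E₀ cB) rI hrI).InsOpRate W δI θ) (hδI : 0 ≤ δI)
    (hGi : 0 ≤ Gi) (hρ₁ : ρ₁ < 1) (hreachI : δI * θ ^ k₁ ≤ ρ₁)
    (hfib : ActOpFibre (labelsIndexing (domainGeometry R) (b13InnerData R)) S.act (step (readAtSlots S ι) E₀ cB) W Aop)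
    (hAop0 : ∀ k g U Z ℓ, 0 ≤ Aop k g U Z ℓ) (hAop0' : ∀ k g U Z ℓ, 0 ≤ Aop' k g U Z ℓ)
    (hdecop : ∀ k g U Z ℓ, Aop k g U Z ℓ ≤ Aop' k g U Z ℓ * Real.exp (-(κ * (R.carriers.d Z + 5)))) (hεop : 0 ≤ εop)
    (h238op : ∀ k, ∀ g ∈ W, ∀ (U : R.carriers.BgB), ∀ Z ∈ R.domAt k,
      actSum (b13InnerData R) (Aop' k g U) k Z ≤ εop * Real.exp (-(Rt * R.carriers.d Z)))
    (hΦopsmall : 36 * (εop * Real.exp 64 * B12TreeDecay.K₀ (4 * 2 ^ 4) (2 * 4)) < 1)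
    (hexp : ActExpLinearOn (labelsIndexing (domainGeometry R) (b13InnerData R)) S.act Dt
      (ballClass (selfCtr (assembly (readAtSlots S ι)).raw (assembly (readAtSlots S ι)).histRef) ROp RHist) W)
    (hN : ActExpNormBound (labelsIndexing (domainGeometry R) (b13InnerData R)) Dt
      (ballClass (selfCtr (assembly (readAtSlots S ι)).raw (assembly (readAtSlots S ι)).histRef) ROp RHist) W S.rHist N)
    (hN0 : ∀ k g U Z ℓ, 0 ≤ N k g U Z ℓ) (hNle : ∀ k g U Z ℓ, N k g U Z ℓ ≤ Nbar) (hNbar : 0 ≤ Nbar)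
    (habs : ActAbsBound (labelsIndexing (domainGeometry R) (b13InnerData R)) Dt
      (ballClass (selfCtr (assembly (readAtSlots S ι)).raw (assembly (readAtSlots S ι)).histRef) ROp RHist) W A)
    (hA0 : ∀ k g U Z ℓ, 0 ≤ A k g U Z ℓ) (hA0' : ∀ k g U Z ℓ, 0 ≤ A' k g U Z ℓ) (hκ : 0 ≤ κ)
    (hdec : ∀ k g U Z ℓ, A k g U Z ℓ ≤ A' k g U Z ℓ * Real.exp (-(κ * (R.carriers.d Z + 5))))
    (hε : 0 ≤ ε)
    (h238 : ∀ k, ∀ g ∈ W, ∀ (U : R.carriers.BgB), ∀ Z ∈ R.domAt k,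
      actSum (b13InnerData R) (A' k g U) k Z ≤ ε * Real.exp (-(Rt * R.carriers.d Z)))
    (hRt : 64 * Real.log 162 + 64 ≤ Rt) (hΦsmall : 36 * (ε * Real.exp 64 * B12TreeDecay.K₀ (4 * 2 ^ 4) (2 * 4)) < 1)
    (hOp : ∀ k, c₁ / r₀ * S.rOp k ≤ ROp k) (hHist : ∀ k, (assembly S).bHist E₀ cB k ≤ RHist k)
    (hHistA : ∀ k, (Gi * δI / (1 - ρ₁) + 2 * Gi / θ ^ k₁) * S.rHist k + EA₀ * (S.rHist k * (cA / (1 - S.D.ω))) ≤ RHist k)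
    (hEA₀ : 0 ≤ EA₀) (hE₀ : 0 ≤ E₀) (hcA : 0 ≤ cA) (hcB : 0 ≤ cB)
    (hc₁ : 0 ≤ c₁) (hr₀ : 0 < r₀) (hθ0 : 0 < θ) (hθ1 : θ < 1) (hθθ' : θ ≤ θ') (hθ'1 : θ' ≤ 1) (hω : 0 < S.D.ω)
    (hω1 : S.D.ω < 1) (hρ₀ : 0 < ρ₀) (hρ₀1 : ρ₀ < 1)
    (hsmall : S.D.ω + 2 * (Nbar * ((ε * Real.exp 64 * B12TreeDecay.K₀ (4 * 2 ^ 4) (2 * 4)) /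
          (1 - 36 * (ε * Real.exp 64 * B12TreeDecay.K₀ (4 * 2 ^ 4) (2 * 4))) ^ 2)) * cA < θ') :
    ∃ C₅, NE5 (outA (readAtSlots S ι) E₀ cB) (outB (readAtSlots S ι) E₀ cB) W κ θ' C₅ := by
  obtain ⟨k₀, hk₀⟩ := OutputRateArithmetic.reach_scale_exists (D := c₁ / r₀) (h := 0) (div_nonneg hc₁ hr₀.le) hθ1 hρ₀
  rw [add_zero] at hk₀
  exact ⟨_, ne5_of_record_secant_structural (readAtSlots S ι) E₀ cB rI hrI (transportReads_record_readAt S ι W) hbB hbA hdA hdB hRA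
    hRB hwer hfl hcomp hIA hirate hδI hGi hρ₁ hreachI hfib hAop0 hAop0' hdecop hεop h238op hΦopsmall hexp hN hN0 hNle hNbar habs hA0
    hA0' hκ hdec hε h238 hRt hΦsmall hOp hHist hHistA hEA₀ hE₀ (one_pos : (0 : ℝ) < 1) hcA hcB hc₁ hr₀ hθ0 hθθ' hθ'1 hω hω1 hρ₀.le
    hρ₀1 hk₀ (le_max_left 0 ((EA₀ + E₀) / θ ^ k₀)) (fun k hk => OutputRateResidual.first_scales_const hθ0 hθ1.le hk.le) hsmall⟩

/-! ## §4 One level down on the operator side: factors that are dominated holomorphic integrals of the operator datum -/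

/-- [folklore] **E8[rec] FROM THE OWNER's STRUCTURAL CLASS `ActOpIntegral`**: §2 with `hfib := actOpFibre_of_integral hint` — each (2.14)
factor, at each base point, IS a dominated holomorphic parametric integral `∫ f … o a dμ` of the operator datum on an operator domain
`𝒪op ⊇ closedBall p.1 (rOp k)`, with ONE majorant of mass `≤ Aop` on the ball (the (H-rep) dictionary of `OutputRateOpHolomorphic`;
NOT PRINTED).  Conclusion LITERALLY `NE5 (outA S E₀ cB) (outB S E₀ cB) W κ θ′ C₅`, the same `C₅` as §2.  NOT a proof of NE5. -/
theorem ne5_of_record_secant_integral {W : Set (ℕ → ℝ)} {ROp RHist : ℕ → ℝ}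
    {N A A' Aop Aop' : ℕ → (ℕ → ℝ) → R.carriers.BgB → R.carriers.Dom → InnerLabel R.carriers.Dom (Bnd R) → ℝ}
    {Dt : ActData R.carriers.Dom (InnerLabel R.carriers.Dom (Bnd R)) (OpDatum E) Hist Ω}
    {κ Nbar ε εop Rt EA₀ E₁ cA c₁ r₀ Gi δI ρ₁ θ θ' ρ₀ B : ℝ} {k₀ k₁ : ℕ} (rI : ℕ → ℝ) (hrI : ∀ k, 0 < rI k)
    {Cfg : ℕ → Type*} [∀ k, NormedAddCommGroup (Cfg k)] [∀ k, NormedSpace ℂ (Cfg k)] {cfg : ∀ k, IOp → Cfg k}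
    {Φ : ∀ k, (R.carriers.Dom → ℝ) → Cfg k → Hist} {𝒪 : ℕ → (ℕ → ℝ) → R.carriers.BgB → Set IOp}
    {Dc : ∀ k, (ℕ → ℝ) → R.carriers.BgB → Set (Cfg k)}
    (hT : (assembly S).TransportReads W)
    (hbB : (assembly S).SliceBudgetB W κ cB) (hbA : S.D.SliceBudget (step S E₀ cB) W κ cA)
    (hdA : DecayBound (outA S E₀ cB) W EA₀ κ) (hdB : DecayBound (outB S E₀ cB) W E₀ κ)
    (hRA : RawBounded S.F (assembly S).rawAt W) (hRB : RawBounded S.F S.rawB W)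
    (hwer : WeightedEntrywiseRate S.F (assembly S).rawAt S.rawB W c₁ fun k => θ ^ k) (hfl : ∀ k, r₀ ≤ S.rOp k)
    (hcomp : InsOpComposition (S.D.toInsOpModel (step S E₀ cB) rI hrI) W κ E₀ Gi cfg Φ 𝒪 Dc)
    (hIA : ∀ k, ∀ g ∈ W, ∀ (U : R.carriers.BgB), (S.D.toInsOpModel (step S E₀ cB) rI hrI).opIA g U k ∈ 𝒪 k g U)
    (hirate : (S.D.toInsOpModel (step S E₀ cB) rI hrI).InsOpRate W δI θ) (hδI : 0 ≤ δI) (hGi : 0 ≤ Gi) (hρ₁ : ρ₁ < 1)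
    (hreachI : δI * θ ^ k₁ ≤ ρ₁)
    {α : R.carriers.Dom → InnerLabel R.carriers.Dom (Bnd R) → Type*} [∀ Z j, MeasurableSpace (α Z j)]
    {μ : ∀ Z j, ℕ → Hist → Measure (α Z j)} {f : ∀ Z j, ℕ → Hist → OpDatum E → α Z j → ℂ}
    {𝒪op : ℕ → (ℕ → ℝ) → R.carriers.BgB → OpDatum E × Hist → R.carriers.Dom → InnerLabel R.carriers.Dom (Bnd R) → Set (OpDatum E)}
    (hint : ActOpIntegral (labelsIndexing (domainGeometry R) (b13InnerData R)) S.act (step S E₀ cB) W Aop μ f 𝒪op)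
    (hAop0 : ∀ k g U Z ℓ, 0 ≤ Aop k g U Z ℓ) (hAop0' : ∀ k g U Z ℓ, 0 ≤ Aop' k g U Z ℓ)
    (hdecop : ∀ k g U Z ℓ, Aop k g U Z ℓ ≤ Aop' k g U Z ℓ * Real.exp (-(κ * (R.carriers.d Z + 5)))) (hεop : 0 ≤ εop)
    (h238op : ∀ k, ∀ g ∈ W, ∀ (U : R.carriers.BgB), ∀ Z ∈ R.domAt k,
      actSum (b13InnerData R) (Aop' k g U) k Z ≤ εop * Real.exp (-(Rt * R.carriers.d Z)))
    (hΦopsmall : 36 * (εop * Real.exp 64 * B12TreeDecay.K₀ (4 * 2 ^ 4) (2 * 4)) < 1)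
    (hexp : ActExpLinearOn (labelsIndexing (domainGeometry R) (b13InnerData R)) S.act Dt
      (ballClass (selfCtr (assembly S).raw (assembly S).histRef) ROp RHist) W)
    (hN : ActExpNormBound (labelsIndexing (domainGeometry R) (b13InnerData R)) Dt
      (ballClass (selfCtr (assembly S).raw (assembly S).histRef) ROp RHist) W S.rHist N)
    (hN0 : ∀ k g U Z ℓ, 0 ≤ N k g U Z ℓ) (hNle : ∀ k g U Z ℓ, N k g U Z ℓ ≤ Nbar) (hNbar : 0 ≤ Nbar)
    (habs : ActAbsBound (labelsIndexing (domainGeometry R) (b13InnerData R)) Dt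
      (ballClass (selfCtr (assembly S).raw (assembly S).histRef) ROp RHist) W A)
    (hA0 : ∀ k g U Z ℓ, 0 ≤ A k g U Z ℓ) (hA0' : ∀ k g U Z ℓ, 0 ≤ A' k g U Z ℓ) (hκ : 0 ≤ κ)
    (hdec : ∀ k g U Z ℓ, A k g U Z ℓ ≤ A' k g U Z ℓ * Real.exp (-(κ * (R.carriers.d Z + 5))))
    (hε : 0 ≤ ε)
    (h238 : ∀ k, ∀ g ∈ W, ∀ (U : R.carriers.BgB), ∀ Z ∈ R.domAt k,
      actSum (b13InnerData R) (A' k g U) k Z ≤ ε * Real.exp (-(Rt * R.carriers.d Z)))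
    (hRt : 64 * Real.log 162 + 64 ≤ Rt) (hΦsmall : 36 * (ε * Real.exp 64 * B12TreeDecay.K₀ (4 * 2 ^ 4) (2 * 4)) < 1)
    (hOp : ∀ k, c₁ / r₀ * S.rOp k ≤ ROp k) (hHist : ∀ k, (assembly S).bHist E₀ cB k ≤ RHist k)
    (hHistA : ∀ k, (Gi * δI / (1 - ρ₁) + 2 * Gi / θ ^ k₁) * S.rHist k + EA₀ * (S.rHist k * (cA / (1 - S.D.ω))) ≤ RHist k)
    (hEA₀ : 0 ≤ EA₀) (hE₀ : 0 ≤ E₀) (hE₁ : 0 < E₁) (hcA : 0 ≤ cA) (hcB : 0 ≤ cB)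
    (hc₁ : 0 ≤ c₁) (hr₀ : 0 < r₀) (hθ0 : 0 < θ) (hθθ' : θ ≤ θ') (hθ'1 : θ' ≤ 1) (hω : 0 < S.D.ω)
    (hω1 : S.D.ω < 1) (hρ₀ : 0 ≤ ρ₀) (hρ₀1 : ρ₀ < 1) (hreach : c₁ / r₀ * θ ^ k₀ ≤ ρ₀) (hB : 0 ≤ B) (hfirst : ∀ k < k₀, EA₀ + E₀ ≤ B * θ ^ k)
    (hsmall : S.D.ω + 2 * (Nbar * ((ε * Real.exp 64 * B12TreeDecay.K₀ (4 * 2 ^ 4) (2 * 4)) /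
          (1 - 36 * (ε * Real.exp 64 * B12TreeDecay.K₀ (4 * 2 ^ 4) (2 * 4))) ^ 2)) * cA < θ') :
    NE5 (outA S E₀ cB) (outB S E₀ cB) W κ θ'
      (((1 / (1 - ρ₀) * ((εop * Real.exp 64 * B12TreeDecay.K₀ (4 * 2 ^ 4) (2 * 4)) /
          (1 - 36 * (εop * Real.exp 64 * B12TreeDecay.K₀ (4 * 2 ^ 4) (2 * 4))) ^ 2)) * (c₁ / r₀) + 2 * (Nbar * ((ε * Real.exp 64 * B12TreeDecay.K₀ (4 * 2 ^ 4) (2 * 4)) /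
          (1 - 36 * (ε * Real.exp 64 * B12TreeDecay.K₀ (4 * 2 ^ 4) (2 * 4))) ^ 2)) *
          (Gi * δI / (1 - ρ₁) + 2 * Gi / θ ^ k₁) + B) * (θ' - S.D.ω) /
        (θ' - (S.D.ω + 2 * (Nbar * ((ε * Real.exp 64 * B12TreeDecay.K₀ (4 * 2 ^ 4) (2 * 4)) /
          (1 - 36 * (ε * Real.exp 64 * B12TreeDecay.K₀ (4 * 2 ^ 4) (2 * 4))) ^ 2)) * cA))) :=
  ne5_of_record_secant_structural S E₀ cB rI hrI hT hbB hbA hdA hdB hRA hRB hwer hfl hcomp hIA hirate hδI hGi hρ₁ hreachI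
    (actOpFibre_of_integral hint) hAop0 hAop0' hdecop hεop h238op hΦopsmall hexp hN hN0 hNle hNbar habs hA0 hA0' hκ hdec hε h238 hRt
    hΦsmall hOp hHist hHistA hEA₀ hE₀ hE₁ hcA hcB hc₁ hr₀ hθ0 hθθ' hθ'1 hω hω1 hρ₀ hρ₀1 hreach hB hfirst hsmall

end OfRecord

end Summit.QuantumFields.BalabanUV.T4Continuum.B13StepOfRecordSecantStructural

end
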